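import Summits.FinalStateConjecture.FinalStateConjecture.Theorems.PhaseMixingCaptureCaptureSufficesTameKickReduction
import Literature.Geometry.Lorentzian.WeightedNorms
import Literature.Geometry.Lorentzian.KerrData
import Literature.Geometry.Lorentzian.LeviCivita
import HarnessLib

/-!
# `CaptureSufficesTame` (stmt-FinalStateConjecture-17270, route PhaseMixingCapture, rank 6): the SPLIT GLUE
# `CensoredExteriorsSettle → SubextremalUpgrade → UnparkingKick → CaptureSufficesTame` (crux-strategist s1, 2026-08-17)

Theses-free wrapper (hypotheses and conclusion are the item BODIES verbatim, so that its type δ-unfolds to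
`PhaseMixingCapture.CensoredExteriorsSettle → PhaseMixingCapture.SubextremalUpgrade → PhaseMixingCapture.UnparkingKick →
PhaseMixingCapture.CaptureSufficesTame` once the split installs the three children in the route file) around the landed
reduction `finalStateConjecture_of_unparkingKick : W → A → U → R → FinalStateConjecture` (p133919, this namespace):
the crux `CaptureSufficesTame := NearExtremalKappaCapture → BulkKerrCaptureC2 → WeakCosmicCensorshipTame → FinalStateConjecture`
follows from (A) = item stmt-17296 (`GlobalAttraction.CensoredExteriorsSettle`, pointwise honest C⁰ settling of censored MGHDs),
(U) = item stmt-17298 (`GlobalAttraction.SubextremalUpgrade`, honest C⁰-with-sub-extremal-labels ⇒ honest C² sub-extremal) and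
(R) = `UnparkingKick` (the relative third law along censored tame curves, ∃-form — the registered `stub_unparkingKick` of line
only-the-third-law-is-generic): its first two hypotheses are introduced and dropped (idle as typed under T2, Disproof §0
`captureSufficesTame_of_bare`; ADM pinning, BarrierNotesIdeator1 BN1-1) and the third, tame weak cosmic censorship, is the (W) of the
reduction. Pure logic. [folklore]
-/

set_option linter.dupNamespace false

noncomputable section

namespace Summit.FinalStateConjecture.FinalStateConjecture.Theorems.PhaseMixingCaptureCaptureSufficesTame

open scoped Manifold ContDiff Topology ENNReal

/-- **Split glue for `CaptureSufficesTame`**: (A) item stmt-17296 verbatim → (U) item stmt-17298 verbatim → (R) `UnparkingKick`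
verbatim → the BODY of `PhaseMixingCapture.CaptureSufficesTame` verbatim (`NearExtremalKappaCapture → BulkKerrCaptureC2 →
WeakCosmicCensorshipTame → FinalStateConjecture`, each unfolded). Proof: drop the two captures, feed tame censorship and (A), (U),
(R) to `finalStateConjecture_of_unparkingKick`. [folklore] -/
theorem captureSufficesTame_of_subs :
    (∀ (X : Type) [TopologicalSpace X] [ChartedSpace Literature.Geometry.Lorentzian.E3 X] [IsManifold (𝓡 3) ((⊤ : ℕ∞) : WithTop ℕ∞) X] [T2Space X] [SecondCountableTopology X] [ConnectedSpace X], ∀ D ∈ Literature.Geometry.Lorentzian.admissibleVacuumData X, ∀ 𝒟 : Literature.Geometry.Lorentzian.VacuumCauchyDevelopment D, 𝒟.IsMaximal → Summit.FinalStateConjecture.HasCompleteNullInfinity 𝒟.toCauchyDevelopment → ∃ (O : Set 𝒟.carrier) (d : Literature.Geometry.Lorentzian.FinalStateDecomposition 𝒟.toSpacetime O 0), O = Summit.FinalStateConjecture.exteriorOf 𝒟.toCauchyDevelopment d.charted ∧ Summit.FinalStateConjecture.RaysStayInClosure 𝒟.toCauchyDevelopment O ∧ Summit.FinalStateConjecture.HasExhaustiveCharts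 d ∧ Summit.FinalStateConjecture.IsFutureOriented d) →
    (∀ (X : Type) [TopologicalSpace X] [ChartedSpace Literature.Geometry.Lorentzian.E3 X] [IsManifold (𝓡 3) ((⊤ : ℕ∞) : WithTop ℕ∞) X] [T2Space X] [SecondCountableTopology X] [ConnectedSpace X], ∀ D ∈ Literature.Geometry.Lorentzian.admissibleVacuumData X, ∀ 𝒟 : Literature.Geometry.Lorentzian.VacuumCauchyDevelopment D, 𝒟.IsMaximal → Summit.FinalStateConjecture.HasCompleteNullInfinity 𝒟.toCauchyDevelopment → ∀ (O : Set 𝒟.carrier) (d₀ : Literature.Geometry.Lorentzian.FinalStateDecomposition 𝒟.toSpacetime O 0), O = Summit.FinalStateConjecture.exteriorOf 𝒟.toCauchyDevelopment d₀.charted → Summit.FinalStateConjecture.RaysStayInClosure 𝒟.toCauchyDevelopment O → Summit.FinalStateConjecture.HasExhaustiveCharts d₀ → Summit.FinalStateConjecture.IsFutureOriented d₀ → (∀ i, Literature.Geometry.Lorentzian.Kerr.IsSubextremal (d₀.mass i) (d₀.spin i)) → ∃ (O' : Set 𝒟.carrier) (d : Literature.Geometry.Lorentzian.FinalStateDecomposition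 𝒟.toSpacetime O' 2), (∀ i, Literature.Geometry.Lorentzian.Kerr.IsSubextremal (d.mass i) (d.spin i)) ∧ O' = Summit.FinalStateConjecture.exteriorOf 𝒟.toCauchyDevelopment d.charted ∧ Summit.FinalStateConjecture.RaysStayInClosure 𝒟.toCauchyDevelopment O' ∧ Summit.FinalStateConjecture.HasExhaustiveCharts d ∧ Summit.FinalStateConjecture.IsFutureOriented d) →
    (∀ (X : Type) [TopologicalSpace X] [ChartedSpace Literature.Geometry.Lorentzian.E3 X] [IsManifold (𝓡 3) ((⊤ : ℕ∞) : WithTop ℕ∞) X] [T2Space X] [SecondCountableTopology X] [ConnectedSpace X], ∀ (e : Literature.Geometry.Lorentzian.AFEnd X) (F : EuclideanSpace ℝ (Fin 1) → Literature.Geometry.Lorentzian.InitialDataSet (𝓡 3) X), Literature.Geometry.Lorentzian.InitialDataSet.IsTameDataFamily e 1 F → ((Literature.Geometry.Lorentzian.InitialDataSet.IsImmersedAtZero 1 F ∧ Function.Injective F) ∨ ∀ c, F c = F 0) → (∀ c, F c ∈ Literature.Geometry.Lorentzian.admissibleVacuumData X) → (∀ c ≠ 0, (∃ 𝒟 : Literature.Geometry.Lorentzian.VacuumCauchyDevelopment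 (F c), 𝒟.IsMaximal) ∧ ∀ 𝒟 : Literature.Geometry.Lorentzian.VacuumCauchyDevelopment (F c), 𝒟.IsMaximal → Summit.FinalStateConjecture.HasCompleteNullInfinity 𝒟.toCauchyDevelopment) → ¬ (((∃ 𝒟 : Literature.Geometry.Lorentzian.VacuumCauchyDevelopment (F 0), 𝒟.IsMaximal) ∧ ∀ 𝒟 : Literature.Geometry.Lorentzian.VacuumCauchyDevelopment (F 0), 𝒟.IsMaximal → Summit.FinalStateConjecture.HasCompleteNullInfinity 𝒟.toCauchyDevelopment) ∧ ∀ 𝒟 : Literature.Geometry.Lorentzian.VacuumCauchyDevelopment (F 0), 𝒟.IsMaximal → Summit.FinalStateConjecture.HasCompleteNullInfinity 𝒟.toCauchyDevelopment ∧ ((∃ (O : Set 𝒟.carrier) (d₀ : Literature.Geometry.Lorentzian.FinalStateDecomposition 𝒟.toSpacetime O 0), O = Summit.FinalStateConjecture.exteriorOf 𝒟.toCauchyDevelopment d₀.charted ∧ Summit.FinalStateConjecture.RaysStayInClosure 𝒟.toCauchyDevelopment O ∧ Summit.FinalStateConjecture.HasExhaustiveCharts d₀ ∧ Summit.FinalStateConjecture.IsFutureOriented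 d₀) → ∃ (O : Set 𝒟.carrier) (d : Literature.Geometry.Lorentzian.FinalStateDecomposition 𝒟.toSpacetime O 0), (∀ i, Literature.Geometry.Lorentzian.Kerr.IsSubextremal (d.mass i) (d.spin i)) ∧ O = Summit.FinalStateConjecture.exteriorOf 𝒟.toCauchyDevelopment d.charted ∧ Summit.FinalStateConjecture.RaysStayInClosure 𝒟.toCauchyDevelopment O ∧ Summit.FinalStateConjecture.HasExhaustiveCharts d ∧ Summit.FinalStateConjecture.IsFutureOriented d)) → ∃ (e' : Literature.Geometry.Lorentzian.AFEnd X) (F' : EuclideanSpace ℝ (Fin 1) → Literature.Geometry.Lorentzian.InitialDataSet (𝓡 3) X), Literature.Geometry.Lorentzian.InitialDataSet.IsTameDataFamily e' 1 F' ∧ F' 0 = F 0 ∧ Function.Injective F' ∧ Literature.Geometry.Lorentzian.InitialDataSet.IsImmersedAtZero 1 F' ∧ (∀ c, F' c ∈ Literature.Geometry.Lorentzian.admissibleVacuumData X) ∧ ∃ ε₀ > (0 : ℝ), ∀ c : EuclideanSpace ℝ (Fin 1), c ≠ 0 → ‖c‖ < ε₀ → (((∃ 𝒟 : Literature.Geometry.Lorentzian.VacuumCauchyDevelopment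 (F' c), 𝒟.IsMaximal) ∧ ∀ 𝒟 : Literature.Geometry.Lorentzian.VacuumCauchyDevelopment (F' c), 𝒟.IsMaximal → Summit.FinalStateConjecture.HasCompleteNullInfinity 𝒟.toCauchyDevelopment) ∧ ∀ 𝒟 : Literature.Geometry.Lorentzian.VacuumCauchyDevelopment (F' c), 𝒟.IsMaximal → Summit.FinalStateConjecture.HasCompleteNullInfinity 𝒟.toCauchyDevelopment ∧ ((∃ (O : Set 𝒟.carrier) (d₀ : Literature.Geometry.Lorentzian.FinalStateDecomposition 𝒟.toSpacetime O 0), O = Summit.FinalStateConjecture.exteriorOf 𝒟.toCauchyDevelopment d₀.charted ∧ Summit.FinalStateConjecture.RaysStayInClosure 𝒟.toCauchyDevelopment O ∧ Summit.FinalStateConjecture.HasExhaustiveCharts d₀ ∧ Summit.FinalStateConjecture.IsFutureOriented d₀) → ∃ (O : Set 𝒟.carrier) (d : Literature.Geometry.Lorentzian.FinalStateDecomposition 𝒟.toSpacetime O 0), (∀ i, Literature.Geometry.Lorentzian.Kerr.IsSubextremal (d.mass i) (d.spin i)) ∧ O = Summit.FinalStateConjecture.exteriorOf 𝒟.toCauchyDevelopment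 d.charted ∧ Summit.FinalStateConjecture.RaysStayInClosure 𝒟.toCauchyDevelopment O ∧ Summit.FinalStateConjecture.HasExhaustiveCharts d ∧ Summit.FinalStateConjecture.IsFutureOriented d))) →
    ((∀ [Literature.Geometry.Lorentzian.Kerr.Facts] [Literature.Geometry.Lorentzian.Kerr.SliceFacts], ∃ (s : ℕ) (δ : ℝ) (k : ℕ) (γ p a₁ : ℝ), a₁ < 1 ∧ ∀ (M : ℝ) (hM : 0 < M), ∃ c > (0 : ℝ), ∃ C : ℝ, ∀ a : ℝ, a₁ * M ≤ |a| → Literature.Geometry.Lorentzian.Kerr.IsSubextremal M a → ∀ (D : Literature.Geometry.Lorentzian.InitialDataSet 𝓘(ℝ, Literature.Geometry.Lorentzian.E3) (Literature.Geometry.Lorentzian.Kerr.slice a M)) [D.metric.HasLeviCivita], D.IsVacuumConstraintSolution → Literature.Geometry.Lorentzian.InitialDataSet.dataWeightedSobolevEDist s δ D (Literature.Geometry.Lorentzian.Kerr.data M a M hM.le) < ENNReal.ofReal (c * (1 - (a / M) ^ 2) ^ γ) → ∀ 𝒟 : Literature.Geometry.Lorentzian.VacuumCauchyDevelopment D, 𝒟.IsMaximal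 → ∃ (M' a' : ℝ) (𝒟oc : Set 𝒟.carrier), Literature.Geometry.Lorentzian.Kerr.IsSubextremal M' a' ∧ (∀ [𝒟.metric.HasLeviCivita], ∃ B₀ : Set (Literature.Geometry.Lorentzian.Kerr.slice a M), IsCompact B₀ ∧ ∀ σ : ℝ, 0 < σ → ∃ B₁ : Set (Literature.Geometry.Lorentzian.Kerr.slice a M), IsCompact B₁ ∧ ∀ q ∈ {q : Literature.Geometry.Lorentzian.Kerr.slice a M | Literature.Geometry.Lorentzian.Kerr.afRadius a M + 1 ≤ ‖(q : Literature.Geometry.Lorentzian.E3)‖}, q ∉ B₁ → ∀ (ray : ℝ → 𝒟.carrier) (dom : Set ℝ), 𝒟.metric.IsNormalisedNullRayFrom 𝒟.timeOrientation 𝒟.embed 𝒟.normal q ray dom → ¬ BddAbove dom ∨ ENNReal.ofReal σ ≤ Literature.Geometry.Lorentzian.sojournTime ray dom (𝒟.metric.causalFuture 𝒟.timeOrientation (𝒟.embed '' B₀))) ∧ 𝒟.toSpacetime.ConvergesToKerr 𝒟oc M' a' k ∧ |M' - M| + |a' - a| ≤ C * (1 - (a / M) ^ 2) ^ (-p) *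 √(Literature.Geometry.Lorentzian.InitialDataSet.dataWeightedSobolevEDist s δ D (Literature.Geometry.Lorentzian.Kerr.data M a M hM.le)).toReal) →
      (∀ [Literature.Geometry.Lorentzian.Kerr.Facts] [Literature.Geometry.Lorentzian.Kerr.SliceFacts], ∀ a₁ : ℝ, a₁ < 1 → ∃ (s : ℕ) (δ : ℝ), ∀ (M : ℝ) (hM : 0 < M), ∀ η > (0 : ℝ), ∃ ε > (0 : ℝ), ∀ a : ℝ, |a| ≤ a₁ * M → ∀ (D : Literature.Geometry.Lorentzian.InitialDataSet 𝓘(ℝ, Literature.Geometry.Lorentzian.E3) (Literature.Geometry.Lorentzian.Kerr.slice a M)) [D.metric.HasLeviCivita], D.IsVacuumConstraintSolution → (∀ s' : ℕ, Literature.Geometry.Lorentzian.InitialDataSet.dataWeightedSobolevEDist s' δ D (Literature.Geometry.Lorentzian.Kerr.data M a M hM.le) < ⊤) → Literature.Geometry.Lorentzian.InitialDataSet.dataWeightedSobolevEDist s δ D (Literature.Geometry.Lorentzian.Kerr.data M a M hM.le) < ENNReal.ofReal ε → ∀ 𝒟 : Literature.Geometry.Lorentzian.VacuumCauchyDevelopment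 D, 𝒟.IsMaximal → ∃ (M' a' : ℝ) (𝒟oc : Set 𝒟.carrier), Literature.Geometry.Lorentzian.Kerr.IsSubextremal M' a' ∧ (∀ [𝒟.metric.HasLeviCivita], ∃ B₀ : Set (Literature.Geometry.Lorentzian.Kerr.slice a M), IsCompact B₀ ∧ ∀ σ : ℝ, 0 < σ → ∃ B₁ : Set (Literature.Geometry.Lorentzian.Kerr.slice a M), IsCompact B₁ ∧ ∀ q ∈ {q : Literature.Geometry.Lorentzian.Kerr.slice a M | Literature.Geometry.Lorentzian.Kerr.afRadius a M + 1 ≤ ‖(q : Literature.Geometry.Lorentzian.E3)‖}, q ∉ B₁ → ∀ (ray : ℝ → 𝒟.carrier) (dom : Set ℝ), 𝒟.metric.IsNormalisedNullRayFrom 𝒟.timeOrientation 𝒟.embed 𝒟.normal q ray dom → ¬ BddAbove dom ∨ ENNReal.ofReal σ ≤ Literature.Geometry.Lorentzian.sojournTime ray dom (𝒟.metric.causalFuture 𝒟.timeOrientation (𝒟.embed '' B₀))) ∧ 𝒟.toSpacetime.ConvergesToKerr 𝒟oc M' a' 2 ∧ |M' - M| + |a' - a| ≤ η) →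
      (∀ (X : Type) [TopologicalSpace X] [ChartedSpace Literature.Geometry.Lorentzian.E3 X] [IsManifold (𝓡 3) ((⊤ : ℕ∞) : WithTop ℕ∞) X] [T2Space X] [SecondCountableTopology X] [ConnectedSpace X], Literature.Geometry.Lorentzian.InitialDataSet.IsTameChristodoulouGeneric (Literature.Geometry.Lorentzian.admissibleVacuumData X) (fun D ↦ (∃ 𝒟 : Literature.Geometry.Lorentzian.VacuumCauchyDevelopment D, 𝒟.IsMaximal) ∧ ∀ 𝒟 : Literature.Geometry.Lorentzian.VacuumCauchyDevelopment D, 𝒟.IsMaximal → Summit.FinalStateConjecture.HasCompleteNullInfinity 𝒟.toCauchyDevelopment) 1) →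
      _root_.FinalStateConjecture) :=
  fun hA hU hR _ _ hW ↦ finalStateConjecture_of_unparkingKick hW hA hU hR

end Summit.FinalStateConjecture.FinalStateConjecture.Theorems.PhaseMixingCaptureCaptureSufficesTame

end
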